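import Literature.AnabelianGeometry.AbsoluteAnabelian.AutHolomorphicSpaces
import Literature.AnabelianGeometry.AbsoluteAnabelian.MonoAnalyticLogShells
import Mathlib.Topology.Instances.ZMod
import HarnessLib

/-!
# [AbsTopIII] Def 2.1 (ii) `IsFiniteEtale` and Def 5.6 (i) `IsOpenInjection` (FACT-LIST F-2449 / F-2474)
# are DEFINITIONS: their universal closures are refutable, their instances are in the tree

S. Mochizuki, *Topics in absolute anabelian geometry III: global reconstruction algorithms*,
J. Math. Sci. Univ. Tokyo 22 (2015) [MochizukiAbsTopIII2015]; manuscript pages (`paper:url-5493eb38cbb7`):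
Def. 2.1 (ii) p. 51 ("finite étale" local morphisms of Aut-holomorphic spaces), Def. 5.6 (i) p. 134
(morphisms of `TG⊢`: open injections of profinite groups).

PROOF-ONLY negative-knowledge file (no definition, no instance) next to `AutHolomorphicSpaces.lean`
(abc-iut-L4-t2) and `MonoAnalyticLogShells.lean` (abc-iut-L4-t3), abc-iut cell seat abc-iut-f-003
(FACT-LIST rows **F-2449** `IsFiniteEtale` (structure) and **F-2474** `IsOpenInjection` (structure), class
`preparatory`, kernel_closedness `parametrised`).

Both rows are `structure … : Prop` PREDICATES that TYPE A PRINTED DEFINITION — `IsFiniteEtale φ`: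
"`φ^top` is a finite covering space map" (a covering map with finite fibres); `IsOpenInjection f`: "an open
injection of profinite groups" — and are consumed as such (fields `finiteEtale` / `cov_finiteEtale` /
`grpHom_isOpenInjection` of the hypothesis structures of §4–§5, the closed fact
`HolomorphicEllipticCuspidalization.NsmulCovIsFiniteEtale`, PROVED as `nsmulCovIsFiniteEtale_holds`).  They
assert nothing by themselves; the kernel instances in the tree are `IsFiniteEtale.id`,
`IsFiniteEtale.of_homeomorph`, `HolomorphicEllipticCuspidalization.isFiniteEtale_nsmulCov`
(`AutHolomorphicSpacesFiniteEtaleProofs.lean`, `HolomorphicEllipticCuspidalizationFiniteEtale.lean`) and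
`PanalocalGaloisTheater.isOpenInjection_id` (`PanalocalTPairs.lean`).

This file records the (elementary) kernel objects saying that the UNIVERSAL closures are false, so that
neither row can be mistaken for a closed fact or enter a conditional certificate as a hypothesis binder:
a map with an infinite fibre is not finite étale (`not_isFiniteEtale_of_infinite_preimage`; the constant map
`ℕ → 1`), and the trivial homomorphism out of a nontrivial profinite group is not an open injection
(`not_isOpenInjection_one`; `ℤ/2 → ℤ/2`).  FACT-LIST class for both rows: «predicate (definition) —
universal closure REFUTED, instances PROVED».  Classical; nothing here bears on [IUTchIII] Cor. 3.12 or
takes a side.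
-/

namespace Literature.AnabelianGeometry.AbsoluteAnabelian

open _root_.Topology

universe u

/-! ## F-2449: `IsFiniteEtale` -/

/-- A map with an infinite fibre is not finite étale (Def. 2.1 (ii): finite étale = a finite covering
space map). [cite: MochizukiAbsTopIII2015, Definition 2.1 (ii) p.51] -/
theorem not_isFiniteEtale_of_infinite_preimage {X : Type u} [TopologicalSpace X] {Y : Type u}
    [TopologicalSpace Y] {φ : X → Y} {y : Y} (h : (φ ⁻¹' {y}).Infinite) :
    ¬ Literature.AnabelianGeometry.AbsoluteAnabelian.IsFiniteEtale φ :=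
  fun hφ => h (hφ.finite_fibre y)

/-- The constant map from `ℕ` (any topology) to the point is not finite étale: its fibre is all of `ℕ`.
[cite: MochizukiAbsTopIII2015, Definition 2.1 (ii) p.51] -/
theorem not_isFiniteEtale_const_nat [TopologicalSpace ℕ] :
    ¬ Literature.AnabelianGeometry.AbsoluteAnabelian.IsFiniteEtale (fun _ : ℕ => PUnit.unit.{1}) :=
  not_isFiniteEtale_of_infinite_preimage (y := PUnit.unit)
    (by rw [Set.preimage_const_of_mem (Set.mem_singleton _)]; exact Set.infinite_univ)

/-- **FACT-LIST F-2449, universal closure REFUTED** (universe `0`): not every continuous-or-not map of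
topological spaces is finite étale.  `IsFiniteEtale` is Def. 2.1 (ii)'s notion, a definition; its kernel
instances are `IsFiniteEtale.id`, `IsFiniteEtale.of_homeomorph`,
`HolomorphicEllipticCuspidalization.isFiniteEtale_nsmulCov`. [cite: MochizukiAbsTopIII2015, Definition 2.1 (ii) p.51] -/
theorem not_forall_isFiniteEtale :
    ¬ ∀ (X Y : Type) [TopologicalSpace X] [TopologicalSpace Y] (φ : X → Y),
      Literature.AnabelianGeometry.AbsoluteAnabelian.IsFiniteEtale φ :=
  fun H => not_isFiniteEtale_const_nat (H ℕ PUnit.{1} (fun _ => PUnit.unit))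

/-! ## F-2474: `IsOpenInjection` -/

/-- The trivial homomorphism out of a nontrivial profinite group is not an open injection (it is not
injective). [cite: MochizukiAbsTopIII2015, Def 5.6 (i) p.134] -/
theorem not_isOpenInjection_one {G H : ProfiniteGrp.{u}} [Nontrivial G] :
    ¬ Literature.AnabelianGeometry.AbsoluteAnabelian.IsOpenInjection (1 : G →ₜ* H) := by
  rintro ⟨hinj, -⟩
  obtain ⟨x, y, hxy⟩ := exists_pair_ne G
  exact hxy (hinj (by simp))

/-- **FACT-LIST F-2474, universal closure REFUTED** (universe `0`): not every continuous homomorphism of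
profinite groups is an open injection — the trivial endomorphism of the finite discrete group `ℤ/2ℤ` is
not injective.  `IsOpenInjection` is Def. 5.6 (i)'s notion of morphism of `TG⊢`, a definition; its kernel
instance is `PanalocalGaloisTheater.isOpenInjection_id`. [cite: MochizukiAbsTopIII2015, Def 5.6 (i) p.134] -/
theorem not_forall_isOpenInjection :
    ¬ ∀ (G H : ProfiniteGrp.{0}) (f : G →ₜ* H),
      Literature.AnabelianGeometry.AbsoluteAnabelian.IsOpenInjection f := by
  intro H
  let G : ProfiniteGrp.{0} := ProfiniteGrp.ofFiniteGrp (FiniteGrp.of (Multiplicative (ZMod 2)))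
  have hG : Nontrivial (Multiplicative (ZMod 2)) :=
    ⟨⟨Multiplicative.ofAdd 0, Multiplicative.ofAdd 1,
      Multiplicative.ofAdd.injective.ne (by decide : (0 : ZMod 2) ≠ 1)⟩⟩
  haveI : Nontrivial G := hG
  exact not_isOpenInjection_one (H G G 1)

end Literature.AnabelianGeometry.AbsoluteAnabelian
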